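import Summits.QuantumFields.YangMills.Theses.UnitScaleTilt
import Literature.MathematicalPhysics.QuantumFieldTheory.Balaban1983to89.T3SplitLog
import Literature.MathematicalPhysics.QuantumFieldTheory.Balaban1983to89.T3UpperLiftSplitLog
import Literature.MathematicalPhysics.QuantumFieldTheory.Balaban1983to89.T3ExistSplit
import Summits.QuantumFields.YangMills.Theorems.UnitScaleTiltMinimiserStabilityRegPrAvgActionDefect
import Summits.QuantumFields.YangMills.Theorems.UnitScaleTiltMinimiserStabilityRegPrAvgCurvGrad
import Summits.QuantumFields.YangMills.Theorems.UnitScaleTiltMinimiserStabilityRegPrAttainmentOfLeaves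
import Summits.QuantumFields.YangMills.Theorems.UnitScaleTiltMinimiserStabilityRegPrSmoothLift
import Summits.QuantumFields.YangMills.Theorems.UnitScaleTiltMinimiserStabilityRegPrCritCurvGradLog
import Summits.QuantumFields.YangMills.Theorems.UnitScaleTiltMinimiserStabilityRegPrProp8Iter
import Summits.QuantumFields.YangMills.Theorems.UnitScaleTiltProp7ExactClause1
import HarnessLib

/-!
# «route-R» SKELETON CANDIDATE (second registered line) of the K1 crux child «MinimiserStabilityRegPr» (stmt-QuantumFields-19200): the UNIQUENESS
# clause of [Balaban1985Variational] Prop. 7 WITHOUT the chart of [Balaban1985RegularSpaces] Thm 2, by quadratic growth of the Wilson action along the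
# `ℓ²`-OPTIMAL (4)-REPRESENTATIVE; penned by the fleet lead `ym-ust-19200-p1` (gen 10) on OWNER RULING g24-№2 (HOME route-R3/ym/plan-g24/OWNER-RULING-g24-2-routeR.md)
# — skeleton of record stays v8 (5b4e846794b80374); registration by OPS on an R-request only (`crux write`, no `skeleton check`).

IDEA.  V3 (Prop. 7 from a background (14)) = clause 1 «at most one critical orbit in (6)(ε₀)» ∧ clause 2 «a minimal orbit in (6)(O(1)L³B₃ε₁)».  In v8 the
[B8]-Thm-2 torus supplier (`stub_PV3A`, WANTED W-19200-T2, XL, no supplier) is consumed by CLAUSE 1.  Route R proves clause 1 chart-free: by gen 6's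
`Prop7CompactChart.clause1_of_reprGrowth` it suffices that at every pair of reading-R2 critical `U, W ∈ (6)(ε₀) ∩ fibre(V)` the action GROWS quadratically along
SOME representative of `W` in print's group (4); by gen 10's EXACT plaquette identity (`Prop7ExactExpansion.wilsonAction4_sub_eq_relPlaq`:
`A(W′) − A(U) = Σ_p ½‖R_p − 1‖² + Σ_p ½Re Tr((U(∂p)−1)^*(R_p−1)U(∂p))`, `R_p = W′(∂p)U(∂p)^*`, no remainder) growth follows, SUP-FREE, from two inequalities for the
representative `Y_b = W′_bU_b^* − 1` (`growth_of_relPoincare_T3`): (P) the RELATIVE-CURVATURE POINCARÉ inequality `Σ_b‖Y_b‖² ≤ C_P·L^{2(K−n)}·Σ_p‖R_p − 1‖²` and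
(S) the FIRST-VARIATION bound `Lin_U(Y) ≥ −¼Σ_p‖R_p − 1‖² − C_S·ε₀·L^{−2(K−n)}·Σ_b‖Y_b‖²` (θ-form, `growth_of_relPoincare_theta_T3`) — then
`κ = (1/(4C_P) − (96 + C_S)ε₀)·L^{−2(K−n)} > 0` for `ε₀ < 1/(4C_P(96 + C_S))`.
THE REPRESENTATIVE IS THE `ℓ²`-OPTIMAL ONE (`W′ = W^g`, `g↓ = 1`, `Σ‖Y(W^g)‖² ≤ Σ‖Y(W^v)‖²` for all `v↓ = 1`; exists by compactness, gen 6
`Prop7CompactChart.exists_optimalRepr`, no smallness): it is CANONICAL on the orbit (so (S), which is NOT a property of arbitrary representatives — see the card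
§3 — is meaningful for it), and since gen 10's schema needs no sup bound its `O(ε₀)` point charges at the k-centres (NUMERICS-19200-C4 g6/g7) are harmless.
(P) is stated for a critical `U` against an ARBITRARY competitor of the regular fibre, (S) for CRITICAL PAIRS, both in print's regime (`ε₀ ≤ a`, `B₃ε₁ ≤ ε₀`,
(7)-datum with a (14)-background) and with constants depending on `L, B₃` only (∃ before the member); both are regularity statements about constrained critical
points and their `ℓ²`-optimal relative representatives (card §2–§3).

STUBS (sorries ONLY here): `stub_halvingStep` (v8 VERBATIM, shared by name with BirthV8), `stub_relPoincareOpt` (P; HARDEST: the `ℓ²` coercivity of the pinned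
optimal slice = [Balaban1985BackgroundPropagators] Thm 3.11∕3.12-type positivity with the (0.4)-constraint at a curved background, nonlinear in `R_p`; flat core in
tree `Prop7FlatCoercivityR.flat_coercive_R`, p505901), `stub_firstVariationOpt` (S; Lagrange multipliers `|Λ_c| ≲ ε₀L^{−(K−n)}` read off the divergence clause of (6)
level by level + the contour-PAIR structure of the second variation of the k-fold (0.4)-average, card §3; w1-19200's S4 files `Prop7FirstVariation*` are its
first layer), `stub_existenceMinimalOrbit` (clause 2; NOT new content of route-R: ⇐ BirthV8 rows A ∧ C ∧ D ∧ E by `Prop7PV3CDEAtSPrint.prop7From14At_v8 ∘ (·).2`).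
THEOREMS with no sorry of their own: `clause1_routeR` (clause 1 in V3's binder shape from P ∧ S), `prop7From14_routeR` (BirthV8's V3 text verbatim), `landed_prop8`,
`stub_critCurvGradLog`, `landed_smoothLift`, `landed_avgCurvGrad`, `landed_avgActionDefect`, `variational_of_leaves_log`, and the composition `MinimiserStabilityRegPr_of`
(= v8's, with `h7 := prop7From14_routeR`), which concludes the route decl BY NAME.

References: T. Bałaban, CMP 102 (1985) 277–309 [Balaban1985Variational]; CMP 99 (1985) 389–434 [Balaban1985BackgroundPropagators]; CMP 96 (1984) 223–250
[Balaban1984PropagatorsII]; C. King, CMP 103 (1986) 323–349 [King1986]; P. Federbush, CMP 110 (1987) 293–309 [Federbush1987PhaseCellIII].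
-/

noncomputable section

open MeasureTheory Filter Topology
open scoped BigOperators Matrix.Norms.L2Operator Matrix
open Literature.MathematicalPhysics.QuantumFieldTheory.Balaban1983to89
open Literature.MathematicalPhysics.QuantumFieldTheory.Balaban1983to89.T3ContinuumYM3Torus
open Literature.MathematicalPhysics.QuantumFieldTheory.Balaban1983to89.T3UnitLawDensityEML (ℰp measurableE_ℰp)
open Literature.MathematicalPhysics.QuantumFieldTheory.Balaban1983to89.T3UnitScaleTilt
open Literature.MathematicalPhysics.QuantumFieldTheory.Balaban1983to89.T3TiltDescent
open Literature.MathematicalPhysics.QuantumFieldTheory.Balaban1983to89.T3CruxEstimates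
open Literature.MathematicalPhysics.QuantumFieldTheory.Balaban1983to89.T3ConstrainedMinimiser
open Literature.MathematicalPhysics.QuantumFieldTheory.Balaban1983to89.T3DescentFibreTower
open Literature.MathematicalPhysics.QuantumFieldTheory.Balaban1983to89.T3MinimiserStabilityReduction
open Literature.MathematicalPhysics.QuantumFieldTheory.Balaban1983to89.T3RegularMinimiser
open Literature.MathematicalPhysics.QuantumFieldTheory.Balaban1983to89.T3PrintedRegularMinimiser
open Literature.MathematicalPhysics.QuantumFieldTheory.Balaban1983to89.T3PrintedRegularMinimiserReduction
open Literature.MathematicalPhysics.QuantumFieldTheory.Balaban1983to89.T3PrintedMinimiserExistence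
open Literature.MathematicalPhysics.QuantumFieldTheory.Balaban1983to89.T3LowerAlongMinimisersSplit
open Literature.MathematicalPhysics.QuantumFieldTheory.Balaban1983to89.T3AvgDivergenceSplit
open Literature.MathematicalPhysics.QuantumFieldTheory.Balaban1983to89.T3UpperAlongMinimisersSplit
open Literature.MathematicalPhysics.QuantumFieldTheory.Balaban1983to89.T3UpperLiftSplit
open Literature.MathematicalPhysics.QuantumFieldTheory.Balaban1983to89.T3LowerActionSplit
open Literature.MathematicalPhysics.QuantumFieldTheory.Balaban1983to89.T3ExistSplit
open Literature.MathematicalPhysics.QuantumFieldTheory.Balaban1983to89.T3Thm1Carrier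
open Literature.MathematicalPhysics.QuantumFieldTheory.Balaban1983to89.T3CurvGradLog
open Literature.MathematicalPhysics.QuantumFieldTheory.Balaban1983to89.T3SplitLog
open Literature.MathematicalPhysics.QuantumFieldTheory.Balaban1983to89.T3UpperLiftSplitLog
open Literature.MathematicalPhysics.QuantumFieldTheory.Balaban1983to89.B11 (Prop8Printed)
open Literature.MathematicalPhysics.QuantumFieldTheory.Balaban1983to89.T3Thm1CarrierNative (IsCritR2 Prop7From14At)
open Literature.MathematicalPhysics.QuantumFieldTheory.Balaban1983to89.T3PrintedRegularOrbits (descTransf)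
open BlockAveragingEMLLinearisedBackground (pertVar)
open Summit.QuantumFields.YangMills.Theorems.Prop7CompactChart (exists_optimalRepr clause1_of_reprGrowth)
open Summit.QuantumFields.YangMills.Theorems.Prop7BlendClause1 (pertVar_eq_mul_star plaq_le_of_regPr)
open Summit.QuantumFields.YangMills.Theorems.Prop7ExactExpansion (wilsonAction4_sub_ge_relPlaq_T3)

namespace Summit.QuantumFields.YangMills.Cruxes.MinimiserStabilityRegPr.RouteR

/-! ## §1 Registered stubs (each a genuine lemma of the line; sorries live ONLY here) -/

/-- STUB V2′ (SHARED WITH BirthV8, text verbatim) — THE ONE-STEP HALVING of [Balaban1985Variational] Sect. F at the d = 3 carriers (p. 304: «hence U_k belongs to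
the space (2) with max{B₃ε₁, ½ε₀} instead of ε₀»), for SOME B₃ > 4 and a₅ > 0.  Supplier schema: w3-19200 `Prop8LastMile.halvingLiteral_of_localCharts167`.  XL.
[cite: Balaban1985Variational, Sect. F p.304 before Prop. 8] -/
theorem stub_halvingStep : ∀ (L : ℕ), 1 < L → ∃ B₃ : ℝ, 4 < B₃ ∧ ∃ a₅ : ℝ, 0 < a₅ ∧
    ∀ (i : Idx L) (ε₀ ε₁ : ℝ), 0 < ε₁ → ∀ (V : (famX L i).Bdry) (U : (famX L i).Cfg), (famX L i).Reg7 ε₁ V → (famX L i).InU ε₀ U →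
      (famX L i).InB V U → (famX L i).IsCritical V U → ε₀ ≤ a₅ → (famX L i).InU (max (B₃ * ε₁) (ε₀ / 2)) U := by
  sorry

/-- STUB P (HARDEST) — THE RELATIVE-CURVATURE POINCARÉ INEQUALITY FOR THE `ℓ²`-OPTIMAL (4)-REPRESENTATIVE OF A CRITICAL PAIR, in print's regime: for every block
size `L > 1` and `B₃ > 4` SOME `C_P, a_P > 0` (depending on `L, B₃` only) such that for every member `(F, n < K)`, every `ε₀ ≤ a_P`, `0 < ε₁` with `B₃ε₁ ≤ ε₀`,
every (7)-datum `V` (`PlaqSmall ε₁ V`) admitting a background (14) (`∃ U₀ ∈ 𝔘_k(L³B₃ε₁) ∩ 𝔅_k(V)`), every reading-R2 critical `U ∈ (6)(ε₀) ∩ 𝔅_k(V)`, every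
COMPETITOR `W ∈ (6)(ε₀) ∩ 𝔅_k(V)` (critical or not — the form row E′ of v8/v9 consumes, w4 `PV3E.isMinOn_regFibrePr_of_relSchemaE_T3`) and every `g` with `g↓ = 1`
that is `ℓ²`-OPTIMAL for `W` relative to `U` (`Σ_b‖(W^g)_bU_b* − 1‖² ≤ Σ_b‖(W^v)_bU_b* − 1‖²` for all `v↓ = 1`; exists by
`Prop7CompactChart.exists_optimalRepr`): `Σ_b‖(W^g)_bU_b* − 1‖² ≤ C_P·L^{2(K−n)}·Σ_p‖W^g(∂p)U(∂p)^* − 1‖²`.  Content: the `ℓ²` coercivity of the pinned optimal slice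
(E–L: lattice Landau gauge relative to `U` off the k-centres, gen 6 `optimalRepr_site_stationary`) WITH the (0.4)-constraint — [Balaban1985BackgroundPropagators]
Thm 3.11∕3.12-type positivity (print (3.43), (3.47)) at a curved small-field background, the constant modes per block being pinned by `W^g, U ∈ 𝔅_k(V)`; flat
linear core in tree (`Prop7FlatCoercivityR.flat_coercive_R`, [Balaban1985PropagatorsI] (1.90) with print's `R`); the passage linear curl ↦ `R_p − 1` costs the bulk sup
of the representative (interior regularity, flat core `Prop7FlatInteriorGradient`) and, at the point charges, the parallel-`𝔰𝔲(2)` structure of a Coulomb tail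
(card §2).  L∕XL.  Why it might fail: the pinned slice's spectral gap could degrade for data `V` close to ABELIAN (the residual per-block rotations are pinned only
through `[h, V_c]`); the `L^{2(K−n)}` scaling is false for arbitrary fibre pairs
and comb-type representatives (CARD-19200-V3-g9 §6); for the optimal one rough relative curvature only raises `Σ‖R_p − 1‖²` against `Σ‖Y‖²`, so the competitor
need not be critical. [cite: Balaban1985Variational, Prop. 7 p.299, (141)-(143) p.299; Balaban1985BackgroundPropagators, Thm 3.1 (3.42)-(3.47) pp.397-398,
Thm 3.11 p.416, Thm 3.12 p.423] -/
theorem stub_relPoincareOpt : ∀ (L : ℕ), 1 < L → ∀ (B₃ : ℝ), 4 < B₃ → ∃ CP aP : ℝ, 0 < CP ∧ 0 < aP ∧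
    ∀ (F : T3Family), F.L = L → ∀ (n K : ℕ) (hnK : n < K) (ε₀ ε₁ : ℝ), 0 < ε₁ → ε₀ ≤ aP → B₃ * ε₁ ≤ ε₀ →
      ∀ V : GaugeField (F.P n) 0 (Matrix.specialUnitaryGroup (Fin 2) ℂ), PlaqSmall ε₁ V →
        (∃ U₀ : GaugeField (F.P K) 0 (Matrix.specialUnitaryGroup (Fin 2) ℂ), RegPr F n K ((L : ℝ) ^ 3 * B₃ * ε₁) U₀ ∧ U₀ ∈ fibre F ℰp n K hnK.le V) →
        ∀ U W : GaugeField (F.P K) 0 (Matrix.specialUnitaryGroup (Fin 2) ℂ),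
          U ∈ regFibrePr F n K hnK.le ε₀ V → IsCritR2 F n K hnK.le V U → W ∈ regFibrePr F n K hnK.le ε₀ V →
          ∀ g : GaugeTransf (F.P K) 0 (Matrix.specialUnitaryGroup (Fin 2) ℂ), descTransf F n K hnK.le g = (fun _ => 1) →
            (∀ v : GaugeTransf (F.P K) 0 (Matrix.specialUnitaryGroup (Fin 2) ℂ), descTransf F n K hnK.le v = (fun _ => 1) →
              ∑ b : PBond (F.P K) 0, ‖pertVar U (GaugeField.gaugeAct g W) b‖ ^ 2 ≤ ∑ b : PBond (F.P K) 0, ‖pertVar U (GaugeField.gaugeAct v W) b‖ ^ 2) →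
            ∑ b : PBond (F.P K) 0, ‖pertVar U (GaugeField.gaugeAct g W) b‖ ^ 2 ≤
              CP * ((F.L : ℝ) ^ (K - n)) ^ 2 * ∑ p : Plaq (F.P K) 0,
                ‖((GaugeField.plaqHol (GaugeField.gaugeAct g W) p : Matrix.specialUnitaryGroup (Fin 2) ℂ) : Matrix (Fin 2) (Fin 2) ℂ)
                    * star ((GaugeField.plaqHol U p : Matrix.specialUnitaryGroup (Fin 2) ℂ) : Matrix (Fin 2) (Fin 2) ℂ) - 1‖ ^ 2 := by
  sorry

/-- STUB S — THE FIRST VARIATION AT A CRITICAL CONFIGURATION ALONG THE `ℓ²`-OPTIMAL REPRESENTATIVE OF ANOTHER, in print's regime: for every `L > 1`, `B₃ > 4`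
SOME `C_S, a_S > 0` (depending on `L, B₃` only) such that, under the same binders as stub P, the EXACT first-order term of gen 2's expansion at `U` in the direction
`Y = (W^g)U^* − 1` (VERBATIM the fourth conjunct of `Prop7BlendClause1.atMostOneCriticalOrbit_of_reprSchema_T3`, = `−½⟨Y, D^{1*}_U∂U⟩`,
`Prop7FirstVariationCurrent.lin_eq_neg_half_sum_re_trace_mul_covDivT`) satisfies `Lin_U(Y) ≥ −¼·Σ_p‖R_p − 1‖² − C_S·ε₀·L^{−2(K−n)}·Σ_b‖Y_b‖²` — the θ-FORM
(θ = ¼) consumed by `Prop7ExactExpansion.growth_of_relPoincare_theta_T3`: the first variation eats at most half of the relative-curvature term `½Σ‖R_p−1‖²` of the exact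
identity (θ = ½ would be free from minimality of `U`; the content is θ < ½).  Content (card §3): by Lagrange
multipliers at the constrained critical point `U` (`dA_U = Σ_c Λ_c dψ_c`, `ψ = log ∘` k-fold (0.4)-average, surjectivity gen 5 `Prop7CovRightInverse`) and
`ψ(W^g) = ψ(U)`: `Lin_U(log(1+Y)) = −Σ_c Λ_c·r_c`, `r_c` the second-order Taylor remainder of `ψ_c` along the secant; `|Λ_c| ≤ (1+O(ε₀))^j L^{2j} ε₀L^{−3(K−n)}` at
level `j` read off the divergence clause of (6) on the last segment layer (`J = (dψ)^*Λ`), and the second variation of `ψ_c` is a sum over contour PAIRS of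
commutators `[X̃_b, X̃_b′]` whose coefficients, for comb-tree pairs, are the current `J_b′` itself (`< ε₀L^{−3(K−n)}`) — trunk concentration is neutralised by the
very combination the divergence clause bounds; `log(1+Y)` vs `Y`: w1 `Prop7FirstVariationLog` ∕ `…Herm`.  L.  Why it might fail: for ARBITRARY fibre points `W`
(not critical) an adversarial `X` with half its mass on a comb trunk and a bulk part aligned with `[J_b′, ·]` makes `|Lin| ≍ ε₀L^{−(K−n)}Σ‖Y‖²` (card §2(b)) — but such roughness
costs curl energy `Σ‖R_p − 1‖² ≍ Σ‖Y‖²`, whence the θ-form; the statement is kept for CRITICAL pairs and the CANONICAL (optimal) representative (for a general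
competitor a `log L^{K−n}` may enter through the codimension-2 trace inequality, card §2(b)); it would also fail for a representative that is not second-order optimal
on the orbit (at `W = U`, `Lin_U(Y(U^g)) = −½Σ_p‖[g(x), U(∂p)]‖² + O(ε₀L^{−2(K−n)})Σ‖Y‖²` by gauge invariance and the exact identity). [cite: Balaban1985Variational,
Prop. 7 p.299, (6) p.278, (14) p.280, (141)-(143) p.299; Balaban1985BackgroundPropagators, (3.9)-(3.11) p.392] -/
theorem stub_firstVariationOpt : ∀ (L : ℕ), 1 < L → ∀ (B₃ : ℝ), 4 < B₃ → ∃ CS aS : ℝ, 0 < CS ∧ 0 < aS ∧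
    ∀ (F : T3Family), F.L = L → ∀ (n K : ℕ) (hnK : n < K) (ε₀ ε₁ : ℝ), 0 < ε₁ → ε₀ ≤ aS → B₃ * ε₁ ≤ ε₀ →
      ∀ V : GaugeField (F.P n) 0 (Matrix.specialUnitaryGroup (Fin 2) ℂ), PlaqSmall ε₁ V →
        (∃ U₀ : GaugeField (F.P K) 0 (Matrix.specialUnitaryGroup (Fin 2) ℂ), RegPr F n K ((L : ℝ) ^ 3 * B₃ * ε₁) U₀ ∧ U₀ ∈ fibre F ℰp n K hnK.le V) →
        ∀ U W : GaugeField (F.P K) 0 (Matrix.specialUnitaryGroup (Fin 2) ℂ),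
          U ∈ regFibrePr F n K hnK.le ε₀ V → IsCritR2 F n K hnK.le V U → W ∈ regFibrePr F n K hnK.le ε₀ V → IsCritR2 F n K hnK.le V W →
          ∀ g : GaugeTransf (F.P K) 0 (Matrix.specialUnitaryGroup (Fin 2) ℂ), descTransf F n K hnK.le g = (fun _ => 1) →
            (∀ v : GaugeTransf (F.P K) 0 (Matrix.specialUnitaryGroup (Fin 2) ℂ), descTransf F n K hnK.le v = (fun _ => 1) →
              ∑ b : PBond (F.P K) 0, ‖pertVar U (GaugeField.gaugeAct g W) b‖ ^ 2 ≤ ∑ b : PBond (F.P K) 0, ‖pertVar U (GaugeField.gaugeAct v W) b‖ ^ 2) →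
            -((1 / 4) * ∑ p : Plaq (F.P K) 0,
                ‖((GaugeField.plaqHol (GaugeField.gaugeAct g W) p : Matrix.specialUnitaryGroup (Fin 2) ℂ) : Matrix (Fin 2) (Fin 2) ℂ)
                    * star ((GaugeField.plaqHol U p : Matrix.specialUnitaryGroup (Fin 2) ℂ) : Matrix (Fin 2) (Fin 2) ℂ) - 1‖ ^ 2)
              - CS * ε₀ * (((F.L : ℝ) ^ (K - n)) ^ 2)⁻¹ * ∑ b : PBond (F.P K) 0, ‖pertVar U (GaugeField.gaugeAct g W) b‖ ^ 2 ≤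
              ∑ p : Plaq (F.P K) 0, (1 / 2) * ((((((GaugeField.plaqHol U p : Matrix.specialUnitaryGroup (Fin 2) ℂ) : Matrix (Fin 2) (Fin 2) ℂ)) - 1)ᴴ
                * (((((GaugeField.gaugeAct g W ⟨p.src, p.μ⟩ : Matrix.specialUnitaryGroup (Fin 2) ℂ) : Matrix (Fin 2) (Fin 2) ℂ) * star (U ⟨p.src, p.μ⟩ : Matrix (Fin 2) (Fin 2) ℂ) - 1)
                    + (U ⟨p.src, p.μ⟩ : Matrix (Fin 2) (Fin 2) ℂ)
                        * (((GaugeField.gaugeAct g W ⟨p.src.shift p.μ, p.ν⟩ : Matrix.specialUnitaryGroup (Fin 2) ℂ) : Matrix (Fin 2) (Fin 2) ℂ) *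
                            star (U ⟨p.src.shift p.μ, p.ν⟩ : Matrix (Fin 2) (Fin 2) ℂ) - 1)
                        * star (U ⟨p.src, p.μ⟩ : Matrix (Fin 2) (Fin 2) ℂ)
                    - ((U ⟨p.src, p.μ⟩ * U ⟨p.src.shift p.μ, p.ν⟩ * (U ⟨p.src.shift p.ν, p.μ⟩)⁻¹ : Matrix.specialUnitaryGroup (Fin 2) ℂ) :
                          Matrix (Fin 2) (Fin 2) ℂ)
                        * (((GaugeField.gaugeAct g W ⟨p.src.shift p.ν, p.μ⟩ : Matrix.specialUnitaryGroup (Fin 2) ℂ) : Matrix (Fin 2) (Fin 2) ℂ) *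
                            star (U ⟨p.src.shift p.ν, p.μ⟩ : Matrix (Fin 2) (Fin 2) ℂ) - 1)
                        * star ((U ⟨p.src, p.μ⟩ * U ⟨p.src.shift p.μ, p.ν⟩ * (U ⟨p.src.shift p.ν, p.μ⟩)⁻¹ : Matrix.specialUnitaryGroup (Fin 2) ℂ) :
                          Matrix (Fin 2) (Fin 2) ℂ)
                    - ((GaugeField.plaqHol U p : Matrix.specialUnitaryGroup (Fin 2) ℂ) : Matrix (Fin 2) (Fin 2) ℂ)
                        * (((GaugeField.gaugeAct g W ⟨p.src, p.ν⟩ : Matrix.specialUnitaryGroup (Fin 2) ℂ) : Matrix (Fin 2) (Fin 2) ℂ) * star (U ⟨p.src, p.ν⟩ : Matrix (Fin 2) (Fin 2) ℂ) - 1)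
                        * star ((GaugeField.plaqHol U p : Matrix.specialUnitaryGroup (Fin 2) ℂ) : Matrix (Fin 2) (Fin 2) ℂ))
                  * ((GaugeField.plaqHol U p : Matrix.specialUnitaryGroup (Fin 2) ℂ) : Matrix (Fin 2) (Fin 2) ℂ))).trace).re := by
  sorry

/-- STUB E — THE EXISTENCE CLAUSE OF PROP. 7 FROM A BACKGROUND (14), uniformly (OWNER RULING g24-№2 (c), T-free, letter-free): for every `L > 1`, `B₃ > 4` SOME
`a′₁ > 0`, `O₁ ≥ 1` such that for every member, `0 < ε₁ ≤ a′₁`, every (7)-datum `V` and every background `U₀ ∈ 𝔘_k(L³B₃ε₁) ∩ 𝔅_k(V)` there is a MINIMISER of the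
Wilson action over print's regular fibre `(6)(O₁L³B₃ε₁)` (reading R1).  NOT new content of route-R: ⇐ BirthV8 rows A ∧ C ∧ D ∧ E by
`Prop7PV3CDEAtSPrint.prop7From14At_v8 ∘ (·).2` (by name); a Thm-2-free existence (minimiser over the CLOSED fibre + KKT-halving, w3 g0) would be a third line.
L∕XL. [cite: Balaban1985Variational, Prop. 7 p.299, (14) p.280, (141)-(142) p.299] -/
theorem stub_existenceMinimalOrbit : ∀ (L : ℕ), 1 < L → ∀ (B₃ : ℝ), 4 < B₃ → ∃ a₁' O₁ : ℝ, 0 < a₁' ∧ 1 ≤ O₁ ∧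
    ∀ (F : T3Family), F.L = L → ∀ (n K : ℕ) (hnK : n < K) (ε₁ : ℝ), 0 < ε₁ →
      ∀ V : GaugeField (F.P n) 0 (Matrix.specialUnitaryGroup (Fin 2) ℂ), PlaqSmall ε₁ V →
        ∀ U₀ : GaugeField (F.P K) 0 (Matrix.specialUnitaryGroup (Fin 2) ℂ), RegPr F n K ((L : ℝ) ^ 3 * B₃ * ε₁) U₀ → U₀ ∈ fibre F ℰp n K hnK.le V →
          ε₁ ≤ a₁' → ∃ U ∈ regFibrePr F n K hnK.le (O₁ * (L : ℝ) ^ 3 * B₃ * ε₁) V,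
            IsMinOn (fun W : GaugeField (F.P K) 0 (Matrix.specialUnitaryGroup (Fin 2) ℂ) => wilsonAction4 W)
              (regFibrePr F n K hnK.le (O₁ * (L : ℝ) ^ 3 * B₃ * ε₁) V) U := by
  sorry

/-! ## §2 Clause 1 of V3 from stubs P ∧ S (no sorry of its own) -/

/-- **CLAUSE 1 (UNIQUENESS OF THE CRITICAL ORBIT) IN V3's BINDER SHAPE FROM P ∧ S**, with `a₀ := min(a_P, a_S, 1/(8C_P(96 + C_S)))`: at every critical pair the
`ℓ²`-optimal representative (`exists_optimalRepr`) grows the action by `κ·Σ‖Y‖²`, `κ = (1/(4C_P) − (96+C_S)ε₀)L^{−2(K−n)} > 0` (`growth_of_relPoincare_theta_T3`,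
θ = ¼), and gen 6's `clause1_of_reprGrowth` concludes. [cite: Balaban1985Variational, Prop. 7 p.299] -/
theorem clause1_routeR (L : ℕ) (hL : 1 < L) (B₃ : ℝ) (hB₃ : 4 < B₃) : ∃ a₀ : ℝ, 0 < a₀ ∧
    ∀ (i : Idx L) (ε₀ ε₁ : ℝ), 0 < ε₁ → ∀ V : (famX L i).Bdry, (famX L i).Reg7 ε₁ V →
      ∀ U₀ : (famX L i).Cfg, (famX L i).InU ((L : ℝ) ^ 3 * B₃ * ε₁) U₀ → (famX L i).InB V U₀ →
        (ε₀ ≤ a₀ → B₃ * ε₁ ≤ ε₀ → (famX L i).AtMostOneCriticalOrbit ε₀ V) := by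
  obtain ⟨CP, aP, hCP, haP, hP⟩ := stub_relPoincareOpt L hL B₃ hB₃
  obtain ⟨CS, aS, hCS, haS, hS⟩ := stub_firstVariationOpt L hL B₃ hB₃
  have hden : 0 < 8 * CP * (96 + CS) := by positivity
  refine ⟨min aP (min aS (1 / (8 * CP * (96 + CS)))), lt_min haP (lt_min haS (by positivity)), ?_⟩
  refine clause1_of_reprGrowth (L := L) (B₃ := B₃) fun i ε₀ ε₁ hε₁ hε₀ hBε V hV hbg U W hU hcU hW hcW => ?_
  obtain ⟨⟨F, n, K⟩, hF, hnK⟩ := i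
  have hεP : ε₀ ≤ aP := hε₀.trans (min_le_left _ _)
  have hεS : ε₀ ≤ aS := hε₀.trans ((min_le_right _ _).trans (min_le_left _ _))
  have hεc : ε₀ ≤ 1 / (8 * CP * (96 + CS)) := hε₀.trans ((min_le_right _ _).trans (min_le_right _ _))
  have hε : 0 ≤ ε₀ := le_trans (mul_pos (by linarith) hε₁).le hBε
  -- the optimal representative and the two stubs at it
  obtain ⟨g, hg4, hopt⟩ := exists_optimalRepr F hnK.le U W
  have hPg := hP F hF n K hnK ε₀ ε₁ hε₁ hεP hBε V hV hbg U W hU hcU hW g hg4 hopt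
  have hSg := hS F hF n K hnK ε₀ ε₁ hε₁ hεS hBε V hV hbg U W hU hcU hW hcW g hg4 hopt
  -- the growth constant
  have hLk : (0 : ℝ) < ((F.L : ℝ) ^ (K - n)) ^ 2 := by
    have : (0 : ℝ) < F.L := by have := F.hL.2; exact_mod_cast (by omega : 0 < F.L)
    positivity
  have hbr : 1 / (8 * CP) ≤ (1 / 2 - 1 / 4) / CP - 96 * ε₀ - CS * ε₀ := by
    have hCP0 : CP ≠ 0 := hCP.ne'
    have h96 : (96 + CS) ≠ 0 := by positivity
    have h1 : (96 + CS) * ε₀ ≤ 1 / (8 * CP) := by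
      calc (96 + CS) * ε₀ ≤ (96 + CS) * (1 / (8 * CP * (96 + CS))) := mul_le_mul_of_nonneg_left hεc (by positivity)
        _ = 1 / (8 * CP) := by field_simp
    have h2 : (1 / 2 - 1 / 4) / CP = 1 / (8 * CP) + 1 / (8 * CP) := by field_simp; ring
    nlinarith [h1, h2]
  have hκ : 0 < ((1 / 2 - 1 / 4) / CP - 96 * ε₀) * (((F.L : ℝ) ^ (K - n)) ^ 2)⁻¹ - CS * ε₀ * (((F.L : ℝ) ^ (K - n)) ^ 2)⁻¹ := by
    rw [show ((1 / 2 - 1 / 4) / CP - 96 * ε₀) * (((F.L : ℝ) ^ (K - n)) ^ 2)⁻¹ - CS * ε₀ * (((F.L : ℝ) ^ (K - n)) ^ 2)⁻¹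
        = ((1 / 2 - 1 / 4) / CP - 96 * ε₀ - CS * ε₀) * (((F.L : ℝ) ^ (K - n)) ^ 2)⁻¹ by ring]
    exact mul_pos (lt_of_lt_of_le (by positivity) hbr) (inv_pos.mpr hLk)
  refine ⟨g, hg4, _, hκ, ?_⟩
  -- growth along the optimal representative, in the letters of `growth_of_relPoincare_T3`
  have hUr : RegPr F n K ε₀ U := ((mem_regFibrePr_iff F).mp hU).2
  have hY : ∀ b : PBond (F.P K) 0, pertVar U (GaugeField.gaugeAct g W) b =
      ((GaugeField.gaugeAct g W b : Matrix.specialUnitaryGroup (Fin 2) ℂ) : Matrix (Fin 2) (Fin 2) ℂ) * star (U b : Matrix (Fin 2) (Fin 2) ℂ) - 1 :=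
    fun b => pertVar_eq_mul_star U (GaugeField.gaugeAct g W) b
  simp only [hY] at hPg hSg ⊢
  -- growth (inlined θ = ¼ instance of `Prop7ExactExpansion.growth_of_relPoincare_theta_T3`, from the exact identity `wilsonAction4_sub_ge_relPlaq_T3`)
  have hmain := wilsonAction4_sub_ge_relPlaq_T3 F n K (GaugeField.gaugeAct g W) U hε (plaq_le_of_regPr F hUr)
  have hP' : ((1 / 2 - 1 / 4) / CP) * (((F.L : ℝ) ^ (K - n)) ^ 2)⁻¹
        * ∑ b : PBond (F.P K) 0, ‖((GaugeField.gaugeAct g W b : Matrix.specialUnitaryGroup (Fin 2) ℂ) : Matrix (Fin 2) (Fin 2) ℂ) * star (U b : Matrix (Fin 2) (Fin 2) ℂ) - 1‖ ^ 2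
      ≤ (1 / 2 - 1 / 4) * ∑ p : Plaq (F.P K) 0,
          ‖((GaugeField.plaqHol (GaugeField.gaugeAct g W) p : Matrix.specialUnitaryGroup (Fin 2) ℂ) : Matrix (Fin 2) (Fin 2) ℂ)
              * star ((GaugeField.plaqHol U p : Matrix.specialUnitaryGroup (Fin 2) ℂ) : Matrix (Fin 2) (Fin 2) ℂ) - 1‖ ^ 2 := by
    have e : ∀ S : ℝ, ((1 / 2 - 1 / 4) / CP) * (((F.L : ℝ) ^ (K - n)) ^ 2)⁻¹ * (CP * ((F.L : ℝ) ^ (K - n)) ^ 2 * S) = (1 / 2 - 1 / 4) * S := by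
      intro S
      have hCP0 : CP ≠ 0 := hCP.ne'
      have hL0 : ((F.L : ℝ) ^ (K - n)) ^ 2 ≠ 0 := hLk.ne'
      calc ((1 / 2 - 1 / 4) / CP) * (((F.L : ℝ) ^ (K - n)) ^ 2)⁻¹ * (CP * ((F.L : ℝ) ^ (K - n)) ^ 2 * S)
          = (1 / 2 - 1 / 4) * S * ((CP / CP) * ((((F.L : ℝ) ^ (K - n)) ^ 2)⁻¹ * ((F.L : ℝ) ^ (K - n)) ^ 2)) := by ring
        _ = (1 / 2 - 1 / 4) * S := by rw [div_self hCP0, inv_mul_cancel₀ hL0]; ring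
    have key := mul_le_mul_of_nonneg_left hPg (show (0 : ℝ) ≤ ((1 / 2 - 1 / 4) / CP) * (((F.L : ℝ) ^ (K - n)) ^ 2)⁻¹ by positivity)
    rw [e] at key
    exact key
  have e1 : ∑ p : Plaq (F.P K) 0, (1 / 2) * ‖((GaugeField.plaqHol (GaugeField.gaugeAct g W) p : Matrix.specialUnitaryGroup (Fin 2) ℂ) : Matrix (Fin 2) (Fin 2) ℂ)
              * star ((GaugeField.plaqHol U p : Matrix.specialUnitaryGroup (Fin 2) ℂ) : Matrix (Fin 2) (Fin 2) ℂ) - 1‖ ^ 2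
      = (1 / 2) * ∑ p : Plaq (F.P K) 0, ‖((GaugeField.plaqHol (GaugeField.gaugeAct g W) p : Matrix.specialUnitaryGroup (Fin 2) ℂ) : Matrix (Fin 2) (Fin 2) ℂ)
              * star ((GaugeField.plaqHol U p : Matrix.specialUnitaryGroup (Fin 2) ℂ) : Matrix (Fin 2) (Fin 2) ℂ) - 1‖ ^ 2 := by
    rw [Finset.mul_sum]
  have e2 : (((1 / 2 - 1 / 4) / CP - 96 * ε₀) * (((F.L : ℝ) ^ (K - n)) ^ 2)⁻¹ - CS * ε₀ * (((F.L : ℝ) ^ (K - n)) ^ 2)⁻¹)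
        * ∑ b : PBond (F.P K) 0, ‖((GaugeField.gaugeAct g W b : Matrix.specialUnitaryGroup (Fin 2) ℂ) : Matrix (Fin 2) (Fin 2) ℂ) * star (U b : Matrix (Fin 2) (Fin 2) ℂ) - 1‖ ^ 2
      = ((1 / 2 - 1 / 4) / CP) * (((F.L : ℝ) ^ (K - n)) ^ 2)⁻¹
          * ∑ b : PBond (F.P K) 0, ‖((GaugeField.gaugeAct g W b : Matrix.specialUnitaryGroup (Fin 2) ℂ) : Matrix (Fin 2) (Fin 2) ℂ) * star (U b : Matrix (Fin 2) (Fin 2) ℂ) - 1‖ ^ 2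
        - 96 * (ε₀ * (((F.L : ℝ) ^ (K - n)) ^ 2)⁻¹)
          * ∑ b : PBond (F.P K) 0, ‖((GaugeField.gaugeAct g W b : Matrix.specialUnitaryGroup (Fin 2) ℂ) : Matrix (Fin 2) (Fin 2) ℂ) * star (U b : Matrix (Fin 2) (Fin 2) ℂ) - 1‖ ^ 2
        - CS * ε₀ * (((F.L : ℝ) ^ (K - n)) ^ 2)⁻¹
          * ∑ b : PBond (F.P K) 0, ‖((GaugeField.gaugeAct g W b : Matrix.specialUnitaryGroup (Fin 2) ℂ) : Matrix (Fin 2) (Fin 2) ℂ) * star (U b : Matrix (Fin 2) (Fin 2) ℂ) - 1‖ ^ 2 := by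
    ring
  rw [e2]
  rw [e1] at hmain
  linarith [hmain, hP', hSg]

/-! ## §3 V3 (BirthV8's `stub_prop7From14` text VERBATIM) as a theorem modulo P ∧ S ∧ E -/

/-- ROUTE-R's V3 — [Balaban1985Variational] PROPOSITION 7 FROM A BACKGROUND (14) at the d = 3 carriers for every B₃ > 4: clause 1 by `clause1_routeR` (P ∧ S, no
chart), clause 2 by stub E. [cite: Balaban1985Variational, Prop. 7 p.299] -/
theorem prop7From14_routeR : ∀ (L : ℕ), 1 < L → ∀ B₃ : ℝ, 4 < B₃ →
    ∃ a₀ a₁' O₁ : ℝ, 0 < a₀ ∧ 0 < a₁' ∧ 1 ≤ O₁ ∧ ∀ (i : Idx L) (ε₀ ε₁ : ℝ), 0 < ε₁ → ∀ V : (famX L i).Bdry, (famX L i).Reg7 ε₁ V →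
      ∀ U₀ : (famX L i).Cfg, (famX L i).InU ((L : ℝ) ^ 3 * B₃ * ε₁) U₀ → (famX L i).InB V U₀ →
        (ε₀ ≤ a₀ → B₃ * ε₁ ≤ ε₀ → (famX L i).AtMostOneCriticalOrbit ε₀ V) ∧
        (ε₁ ≤ a₁' → ∃ U : (famX L i).Cfg, (famX L i).OnMinimalOrbit (O₁ * (L : ℝ) ^ 3 * B₃ * ε₁) V U) := by
  intro L hL B₃ hB₃
  obtain ⟨a₀, ha₀, h1⟩ := clause1_routeR L hL B₃ hB₃
  obtain ⟨a₁', O₁, ha₁', hO₁, hE⟩ := stub_existenceMinimalOrbit L hL B₃ hB₃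
  refine ⟨a₀, a₁', O₁, ha₀, ha₁', hO₁, fun i ε₀ ε₁ hε₁ V hV U₀ hU₀ hB => ⟨h1 i ε₀ ε₁ hε₁ V hV U₀ hU₀ hB, fun hε₁' => ?_⟩⟩
  obtain ⟨⟨F, n, K⟩, hF, hnK⟩ := i
  obtain ⟨U, hU, hmin⟩ := hE F hF n K hnK ε₁ hε₁ V hV U₀ hU₀ hB hε₁'
  exact ⟨U, hU, hmin⟩

/-- LANDED V2 (modulo V2′) — [Balaban1985Variational] PROPOSITION 8 at the d = 3 carriers, by the kernel-checked halving iteration `Prop8Iter.prop8_of_halvingLiteral`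
(verbatim BirthV8). [cite: Balaban1985Variational, Prop. 8 p.304] -/
theorem landed_prop8 : ∀ (L : ℕ), 1 < L → ∃ B₃ : ℝ, 4 < B₃ ∧ Prop8Printed B₃ (famX L) :=
  Summit.QuantumFields.YangMills.Theorems.Prop8Iter.prop8_of_halvingLiteral stub_halvingStep

/-- LANDED V4′ — the log-Lipschitz curvature gradient of critical configurations in (8), `CritCurvGradLog.stub_critCurvGradLog` (p511133; verbatim BirthV8).
[cite: Balaban1985Variational, Thm 1 (9) p.279; Balaban1985RegularSpaces, Thm 2 p.83, (1.36) p.82] -/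
theorem stub_critCurvGradLog : ∀ (L : ℕ), 1 < L → ∀ B₃ : ℝ, 4 < B₃ → ∃ a₁ B₄ : ℝ, 0 < a₁ ∧ 0 < B₄ ∧ CritCurvGradLogAt L a₁ B₃ B₄ :=
  Summit.QuantumFields.YangMills.Theorems.CritCurvGradLog.stub_critCurvGradLog

/-! ## §4 Landed inputs, by name (verbatim BirthV8) -/

/-- LANDED — located gap G-K1a-2′ (smooth exact one-step lift), p466834. [cite: King1986, (A.5) p.676] -/
theorem landed_smoothLift : ∀ (L : ℕ), ∃ C₁ C₂ c : ℝ, 0 < C₁ ∧ 0 ≤ C₂ ∧ 0 < c ∧ SmoothLiftAt L C₁ C₂ c :=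
  Summit.QuantumFields.YangMills.Theorems.SmoothLift.stub_smoothLift

/-- LANDED — located gap G-K1a-3a′ (first-order regularity of the one-step average), p440643. [cite: Balaban1985Averaging, Prop. 3 (122)-(123) p.36] -/
theorem landed_avgCurvGrad : ∀ (L : ℕ), ∃ C₁ C₂ c : ℝ, 0 ≤ C₁ ∧ 0 < C₂ ∧ 0 < c ∧ AvgCurvGradAt L C₁ C₂ c :=
  Summit.QuantumFields.YangMills.Theorems.AvgCurvGrad.stub_avgCurvGrad

/-- LANDED — located gap G-K1a-3b′ (per-configuration averaging action defect), p437535. [cite: Federbush1987PhaseCellIII, Thm 4.3 (4.5) p.299] -/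
theorem landed_avgActionDefect : ∀ (L : ℕ), ∃ C₂ c : ℝ, 0 ≤ C₂ ∧ 0 < c ∧ AvgActionDefectAt L C₂ c :=
  Summit.QuantumFields.YangMills.Theorems.AvgActionDefect.stub_avgActionDefect

/-- **THE VARIATIONAL DATA FROM THE THREE LEAVES** (verbatim BirthV8, with `h7 := prop7From14_routeR`): attainment over (6) from V3 ∧ V2, `MinimisersIn8At` from V2,
and the log-Lipschitz minimiser schema from V4′ ∧ V2. [cite: Balaban1985Variational, Thm 1 p.279, Prop 7 p.299, Prop 8 p.304] -/
theorem variational_of_leaves_log (L : ℕ) (hL : 1 < L) :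
    ∃ â₀ â₁ a₀ a₁ B₃ B₄ : ℝ, 0 < â₀ ∧ 0 < â₁ ∧ 0 < a₀ ∧ 0 < a₁ ∧ 0 < B₃ ∧ 0 < B₄ ∧
      MinSixAttainedAt L â₀ â₁ B₃ ∧ MinimisersIn8At L a₀ a₁ B₃ ∧ MinimiserCurvGradLogAt L a₀ a₁ B₃ B₄ := by
  obtain ⟨B₃, hB₃, h8⟩ := landed_prop8 L hL
  have h7 := prop7From14_routeR L hL B₃ hB₃
  obtain ⟨a₁, B₄, ha₁, hB₄, hc⟩ := stub_critCurvGradLog L hL B₃ hB₃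
  have hB₃0 : 0 < B₃ := by linarith
  obtain ⟨â₀, â₁, hâ₀, hâ₁, hatt⟩ := Summit.QuantumFields.YangMills.Theorems.Variational.minSixAttainedAt_of_prop7_prop8 hL hB₃ h7 h8
  obtain ⟨a₅, ha₅, h8'⟩ := minimisersIn8At_of_prop8 hB₃0 h8
  exact ⟨â₀, â₁, a₅, a₁, B₃, B₄, hâ₀, hâ₁, ha₅, ha₁, hB₃0, hB₄, hatt, h8' a₁, minimiserCurvGradLogAt_of_crit hB₃0 hc (h8' a₁)⟩

/-! ## §5 The composition — concludes the ROUTE DECL by name, no sorry of its own (verbatim BirthV8) -/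

/-- **`MinimiserStabilityRegPr ⇐ (stub_halvingStep ∧ stub_relPoincareOpt ∧ stub_firstVariationOpt ∧ stub_existenceMinimalOrbit) ∧ landed V4′ ∧ landed_prop8 ∧
landed_smoothLift ∧ landed_avgCurvGrad ∧ landed_avgActionDefect`**: EXIST by `T3ExistSplit.hasRegMinimisersPrAt_of_attained`, UPPER by
`T3UpperLiftSplitLog.upperAlongRegPrMinimisersAt_of_splitLog'`, LOWER by `T3SplitLog.lowerAlongRegPrMinimisersAt_of_splitLog'''`, then
`minimiserStabilityRegPrAt_of_alongRegPrMinimisers`; ε₁ := min of three, m₀ := 10, γ₁ := min of three. [cite: Balaban1985Variational, Thm 1 p.279] -/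
theorem MinimiserStabilityRegPr_of : Summit.QuantumFields.YangMills.Theses.UnitScaleTilt.MinimiserStabilityRegPr := by
  intro L
  by_cases hL : 1 < L
  · obtain ⟨â₀, â₁, a₀, a₁, B₃, B₄, hâ₀, hâ₁, ha₀, ha₁, hB₃, hB₄, hatt, hIn8, hgrad⟩ := variational_of_leaves_log L hL
    -- EXIST
    obtain ⟨e₁, he₁, hE⟩ := hasRegMinimisersPrAt_of_attained hâ₀ hâ₁ hB₃ hatt
    -- UPPER
    obtain ⟨C₁, C₂, c, hC₁, hC₂, hc, hlift⟩ := landed_smoothLift L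
    obtain ⟨e₂, he₂, hU⟩ := upperAlongRegPrMinimisersAt_of_splitLog' ha₀ ha₁ hB₃ hB₄ hC₁ hC₂ hc hIn8 hgrad hlift
    -- LOWER
    obtain ⟨D₁, D₂, d, hD₁, hD₂, hd, havg⟩ := landed_avgCurvGrad L
    obtain ⟨E₂, e, hE₂, he, hdef⟩ := landed_avgActionDefect L
    obtain ⟨e₃, he₃, hLo⟩ := lowerAlongRegPrMinimisersAt_of_splitLog''' hL.le ha₀ ha₁ hB₃ hB₄ hD₂ hd hE₂ he hIn8 hgrad havg hdef
    -- the common `ε₁`, `m₀ = 10`, `γ₁`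
    refine ⟨min e₁ (min e₂ e₃), lt_min he₁ (lt_min he₂ he₃), fun ε₀ hε hεle => ⟨10, fun m hm b₀ p₀ hb hp => ?_⟩⟩
    have hε₁ : ε₀ ≤ e₁ := hεle.trans (min_le_left _ _)
    have hε₂ : ε₀ ≤ e₂ := hεle.trans ((min_le_right _ _).trans (min_le_left _ _))
    have hε₃ : ε₀ ≤ e₃ := hεle.trans ((min_le_right _ _).trans (min_le_right _ _))
    have hm2 : 2 ≤ m := le_trans (by norm_num) hm
    have hp0 : 0 < p₀ := lt_trans two_pos hp
    obtain ⟨γa, hγa, hA⟩ := hE ε₀ hε hε₁ m hm2 b₀ p₀ hb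
    obtain ⟨γb, hγb, hB⟩ := hU ε₀ hε hε₂ m hm b₀ p₀ hb hp0
    obtain ⟨γc, hγc, hC⟩ := hLo ε₀ hε hε₃ m hm b₀ p₀ hb hp0
    refine ⟨min γa (min γb γc), lt_min hγa (lt_min hγb hγc), fun F γ hFL hγ hγle => ?_⟩
    have hγa' : γ ≤ γa := hγle.trans (min_le_left _ _)
    have hγb' : γ ≤ γb := hγle.trans ((min_le_right _ _).trans (min_le_left _ _))
    have hγc' : γ ≤ γc := hγle.trans ((min_le_right _ _).trans (min_le_right _ _))
    exact minimiserStabilityRegPrAt_of_alongRegPrMinimisers hγ.le (hA F γ hFL hγ hγa') (hB F γ hFL hγ hγb') (hC F γ hFL hγ hγc')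
  · -- no member of the family has block size `L ≤ 1`
    exact ⟨1, one_pos, fun ε₀ _ _ => ⟨0, fun m _ b₀ p₀ _ _ => ⟨1, one_pos, fun F γ hFL _ _ => absurd (hFL ▸ F.hL.2) hL⟩⟩⟩

end Summit.QuantumFields.YangMills.Cruxes.MinimiserStabilityRegPr.RouteR

end
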